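import Summits.HodgeConjecture.HodgeCM.PerL34.PrintedTorusMatch_1

/-! PORT of `HodgeCM/PerL34/PrintedTorusMatch.lean` (HodgeCMPerL run 82) — part 2: continuation of `Summits.HodgeConjecture.HodgeCM.PerL34.PrintedTorusMatch_1` (split at a top-level declaration boundary by port_pkg.py; scope re-opened below; declarations unchanged). -/

-- port_pkg: scope re-opened for this part (file-level context, then the namespace/section stack open at the cut)
set_option autoImplicit false
noncomputable section
open Complex
open scoped BigOperators
namespace HodgeCM
namespace RepTorusCarrier
open NumberField NumberField.SeesawArchTorus HodgeCM.PerL34.Fock HodgeCM.PerL34.Fock.PrintDict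
variable {HH HG CG GG SK SigIdxG : Type}
variable [NormedAddCommGroup HH] [InnerProductSpace ℂ HH] [CompleteSpace HH]
variable [NormedAddCommGroup HG] [InnerProductSpace ℂ HG] [CompleteSpace HG]
variable [NormedAddCommGroup CG] [NormedSpace ℂ CG]
variable [Group GG] [TopologicalSpace GG] [TopologicalSpace SK]
variable {C : RepCoreCarrier HH HG CG GG SK SigIdxG} (D : RepTorusCarrier C)
variable {L : Type} [Field L] [NumberField L] [IsCMField L] [DecidableEq (InfinitePlace L)]
variable (kind : InfinitePlace L → PlaceKind) (lam : InfinitePlace L → ℂ) (hlam : ∀ w, lam w ≠ 0)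
/-- **The S4 field for the PRINTED chart on prl1's representation-theoretic torus carrier (KERNEL).**  `C.R` unitary;
the carrier torus `D.torus : D.Tι → G`, `D.w : D.Tι → ℂ` is `T(L₀ ⊗ ℝ)` with the typed weight up to a surjective
reparametrisation `e : SeesawArchTorus L → D.Tι` (`D.w ∘ e = weight L m₁ m₂`; on the end state `D.Tι = SeesawArchTorus L`,
`e := id`, `rfl`); the printed places carry the PINNED vacuum characters and the chart torus `ιT` is `D.torus ∘ e` in
coordinates.  Then the eigenvector premise of the S4 field gives `D.wOccurs c`. -/
theorem wOccurs_of_printedEigenvector (hU : PerL34.Spectral.IsUnitaryRep C.R) (e : SeesawArchTorus L → D.Tι)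
    (he : Function.Surjective e) (m₁ m₂ : InfinitePlace L → ℤ) (hw : ∀ s, D.w (e s) = weight L m₁ m₂ s)
    (ιT : (printPlaces (InfinitePlace L) kind lam hlam (pinnedVacs kind m₁ m₂)).Tg → GG)
    (hι : ∀ t, ιT t = D.torus (e ((placesEquiv L).symm
      (placesCoord (InfinitePlace L) kind lam hlam (pinnedVacs kind m₁ m₂) t))))
    (c : C.SigIdx)
    (h : ∃ y ∈ (RepDecomp.isotypic C.R c).topologicalClosure, y ≠ 0 ∧
      ∀ t : (printPlaces (InfinitePlace L) kind lam hlam (pinnedVacs kind m₁ m₂)).Tg,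
        C.R (ιT t) y = printPlacesW (InfinitePlace L) kind lam hlam (pinnedVacs kind m₁ m₂) t • y) :
    D.wOccurs c := by
  obtain ⟨y, hy, hy0, hyt⟩ := h
  refine D.wOccurs_of_eigenvector hU
    (fun t => e ((placesEquiv L).symm
      (placesCoord (InfinitePlace L) kind lam hlam (pinnedVacs kind m₁ m₂) t)))
    (he.comp ((placesEquiv L).symm.surjective.comp
      (placesCoord (InfinitePlace L) kind lam hlam (pinnedVacs kind m₁ m₂)).surjective))
    c ⟨y, hy, hy0, fun t => ?_⟩
  have ht := hyt t
  rw [hι, printPlacesW_pinned_eq_weight, ← hw] at ht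
  exact ht

/-- The same in the literal binder shapes of the reconstructed gen-2 carrier (`C.toCoreCarrier.hatσC`,
`D.toTorusCarrier.wOccurs`). -/
theorem toTorusCarrier_wOccurs_of_printedEigenvector (hU : PerL34.Spectral.IsUnitaryRep C.R)
    (e : SeesawArchTorus L → D.Tι) (he : Function.Surjective e) (m₁ m₂ : InfinitePlace L → ℤ)
    (hw : ∀ s, D.w (e s) = weight L m₁ m₂ s)
    (ιT : (printPlaces (InfinitePlace L) kind lam hlam (pinnedVacs kind m₁ m₂)).Tg → GG)
    (hι : ∀ t, ιT t = D.torus (e ((placesEquiv L).symm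
      (placesCoord (InfinitePlace L) kind lam hlam (pinnedVacs kind m₁ m₂) t))))
    (c : C.SigIdx)
    (h : ∃ y ∈ C.toCoreCarrier.hatσC c, y ≠ 0 ∧
      ∀ t : (printPlaces (InfinitePlace L) kind lam hlam (pinnedVacs kind m₁ m₂)).Tg,
        C.toCoreCarrier.R (ιT t) y =
          printPlacesW (InfinitePlace L) kind lam hlam (pinnedVacs kind m₁ m₂) t • y) :
    D.toTorusCarrier.wOccurs c :=
  D.wOccurs_of_printedEigenvector kind lam hlam hU e he m₁ m₂ hw ιT hι c h

/-- **The field `PrintedAnalyticSide.wOccurs_of_eigenvector` on the end state, DISCHARGED (KERNEL)** — in the LITERAL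
binder shapes of the frozen Prior records reconstructed from the carriers: `C := C'.toCoreCarrier.toIsolationCore h`,
`D := D'.toTorusCarrier.toTorusData h hD`, `RP := InfinitePlace L`, `vac := pinnedVacs kind m₁ m₂`, any chart torus `ιT`
equal to `D'.torus ∘ e ∘ (placesEquiv L)⁻¹ ∘ placesCoord` (unitarity is the record's own `R_unitary`).  With
`ιT := printedTorusHom kind lam hlam (jT.toMonoidHom.comp (toAdeles L)) _`, `e := id` the two side conditions are `rfl`
on prl1-g4's end state (`Tι := SeesawArchTorus L`, `torus := ⇑(jT.toMonoidHom.comp (toAdeles L))`,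
`w := ⇑(weight L m₁ m₂)`). -/
theorem toTorusData_wOccurs_of_printedEigenvector (h : C.toCoreCarrier.Analytic) (hD : D.toTorusCarrier.Analytic)
    (e : SeesawArchTorus L → D.Tι) (he : Function.Surjective e) (m₁ m₂ : InfinitePlace L → ℤ)
    (hw : ∀ s, D.w (e s) = weight L m₁ m₂ s)
    (ιT : (printPlaces (InfinitePlace L) kind lam hlam (pinnedVacs kind m₁ m₂)).Tg → GG)
    (hι : ∀ t, ιT t = D.torus (e ((placesEquiv L).symm
      (placesCoord (InfinitePlace L) kind lam hlam (pinnedVacs kind m₁ m₂) t))))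
    (c : C.SigIdx)
    (hy : ∃ y ∈ (C.toCoreCarrier.toIsolationCore h).hatσ c, y ≠ 0 ∧
      ∀ t : (printPlaces (InfinitePlace L) kind lam hlam (pinnedVacs kind m₁ m₂)).Tg,
        (C.toCoreCarrier.toIsolationCore h).R (ιT t) y =
          printPlacesW (InfinitePlace L) kind lam hlam (pinnedVacs kind m₁ m₂) t • y) :
    (D.toTorusCarrier.toTorusData h hD).wOccurs c :=
  D.wOccurs_of_printedEigenvector kind lam hlam h.R_unitary e he m₁ m₂ hw ιT hι c hy

end RepTorusCarrier
end HodgeCM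

end
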